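import Mathlib.LinearAlgebra.QuadraticForm.Signature
import Mathlib.LinearAlgebra.BilinearForm.Orthogonal
import HarnessLib

/-!
# Sylvester's law of inertia read on an orthogonal splitting `V = W ⊕ W^⊥`

For a bilinear form `B` on a finite-dimensional vector space `V` over a linearly ordered field and a
subspace `W` on which `B` is positive definite and whose `B`-orthogonal `W^⊥` is negative definite, the
indices of inertia of the quadratic form `Q(x) = B(x, x)` are `b⁺(Q) = dim W` and `b⁻(Q) = dim V - dim W`
(`sigPos_sigNeg_of_posDef_of_orthogonal_neg`; mirror statement `sigNeg_sigPos_of_negDef_of_orthogonal_pos`;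
signature `b⁺ - b⁻ = 2 dim W - dim V`, `signature_eq_of_posDef_of_orthogonal_neg`; and the
orthogonality-free form `sigPos_sigNeg_of_posDef_of_negDef`: `B > 0` on `W₊`, `B < 0` on `W₋`,
`dim W₊ + dim W₋ ≥ dim V` ⇒ `b⁺ = dim W₊`, `b⁻ = dim W₋`).  This is Lang's
Sylvester theorem (Ch. V §8 Thm. 8.2: the number `r` of positive squares in an orthogonal basis does
not depend on the basis) in the form of his Exercise V §8.2 ("`V = V⁺ ⊕ V⁻ ⊕ V₀` … the dimensions of
the spaces `V⁺, V⁻` are the same in all such decompositions"), with Mathlib's `sigPos` ("the maximal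
finrank of a positive definite subspace") as the index of positivity: `dim W ≤ b⁺`, `dim W^⊥ ≤ b⁻`
(`le_sigPos_of_posDef`, `le_sigNeg_of_negDef`), `b⁺ + dim W^⊥ ≤ dim V`, `b⁻ + dim W ≤ dim V`
(`QuadraticForm.sigPos_add_finrank_le_of_nonpos`: a positive definite and a non-positive subspace
meet trivially), and `dim W + dim W^⊥ ≥ dim V` (`LinearMap.BilinForm.finrank_add_finrank_orthogonal'`).
No symmetry of `B` is needed (`W^⊥` is Mathlib's right orthogonal `{y | ∀ w ∈ W, B w y = 0}`).

This is the counting step of the Hodge index theorems of the lane (`W` = the span of the Kähler class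
and the real parts of the `(2,0)`-classes, `W^⊥` = the real primitive `(1,1)`-classes:
`AlgebraicGeometry/HodgeTheory/HodgeIndexSurfaceSigned.lean`; the one-dimensional case `W = ℝ w` is
`sigPos_sigNeg_of_orthogonal_neg` of `LorentzianReverseSchwarz.lean`).

## References

* S. Lang, *Linear Algebra*, 3rd ed., Undergraduate Texts in Mathematics, Springer (1987), Ch. V §8,
  Thm. 8.2 (Sylvester's theorem) and Exercise 2, PDF pp. 115–116 of the held text.
  [cite: Lang1987LinearAlgebra, Ch. V §8 Thm. 8.2 and Exercise 2]
* R. A. Horn, C. R. Johnson, *Matrix Analysis*, 2nd ed. (2012), Thm. 4.5.8 (Sylvester's law of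
  inertia). [cite: HornJohnson2012, Thm. 4.5.8]
-/

noncomputable section

open Module QuadraticMap

namespace Literature.LinearAlgebra.QuadraticForm

variable {𝕜 : Type*} [Field 𝕜] [LinearOrder 𝕜] [IsStrictOrderedRing 𝕜]
variable {V : Type*} [AddCommGroup V] [Module 𝕜 V] [FiniteDimensional 𝕜 V]

/-- **Sylvester's law of inertia on an orthogonal splitting.** If `B` is positive definite on the
subspace `W` and negative definite on its `B`-orthogonal `W^⊥ = {y | ∀ w ∈ W, B w y = 0}`, then
`b⁺(Q) = dim W` and `b⁻(Q) = dim V - dim W` for `Q(x) = B(x, x)` (Lang: "`V = V⁺ ⊕ V⁻ ⊕ V₀` … the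
dimensions of the spaces `V⁺, V⁻` are the same in all such decompositions").
[cite: Lang1987LinearAlgebra, Ch. V §8 Thm. 8.2 and Exercise 2] [cite: HornJohnson2012, Thm. 4.5.8] -/
theorem sigPos_sigNeg_of_posDef_of_orthogonal_neg (B : LinearMap.BilinForm 𝕜 V) (W : Submodule 𝕜 V)
    (hpos : ∀ w ∈ W, w ≠ 0 → 0 < B w w)
    (hneg : ∀ y ∈ LinearMap.BilinForm.orthogonal B W, y ≠ 0 → B y y < 0) :
    sigPos B.toQuadraticMap = finrank 𝕜 W ∧ sigNeg B.toQuadraticMap + finrank 𝕜 W = finrank 𝕜 V := by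
  set Q := B.toQuadraticMap with hQdef
  have hQ : ∀ x, Q x = B x x := fun x ↦ LinearMap.BilinMap.toQuadraticMap_apply B x
  set W' := LinearMap.BilinForm.orthogonal B W with hW'
  have hposW : (Q.restrict W).PosDef := fun x hx ↦ by
    rw [QuadraticMap.restrict_apply, hQ]
    exact hpos x.1 x.2 (fun h ↦ hx (Subtype.ext h))
  have hnegW' : ((-Q).restrict W').PosDef := fun x hx ↦ by
    rw [QuadraticMap.restrict_apply, QuadraticMap.neg_apply, hQ, neg_pos]
    exact hneg x.1 x.2 (fun h ↦ hx (Subtype.ext h))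
  have hnonposW' : ∀ x ∈ W', Q x ≤ 0 := fun x hx ↦ by
    by_cases hx0 : x = 0
    · rw [hx0, hQ, LinearMap.map_zero₂]
    · rw [hQ]; exact (hneg x hx hx0).le
  have hnonposW : ∀ x ∈ W, (-Q) x ≤ 0 := fun x hx ↦ by
    rw [QuadraticMap.neg_apply, neg_nonpos, hQ]
    by_cases hx0 : x = 0
    · rw [hx0, LinearMap.map_zero₂]
    · exact (hpos x hx hx0).le
  have h1 := le_sigPos_of_posDef Q hposW
  have h2 := le_sigNeg_of_negDef Q hnegW'
  have h3 := QuadraticForm.sigPos_add_finrank_le_of_nonpos (Q := Q) hnonposW'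
  have h4 : sigNeg Q + finrank 𝕜 W ≤ finrank 𝕜 V :=
    QuadraticForm.sigPos_add_finrank_le_of_nonpos (Q := -Q) hnonposW
  have h5 := LinearMap.BilinForm.finrank_add_finrank_orthogonal' (B := B) W
  rw [← hW'] at h5
  constructor <;> omega

/-- The signature on an orthogonal splitting: `b⁺(Q) - b⁻(Q) = 2 dim W - dim V` when `B` is positive
definite on `W` and negative definite on `W^⊥`. [cite: Lang1987LinearAlgebra, Ch. V §8 Thm. 8.2 and Exercise 2] -/
theorem signature_eq_of_posDef_of_orthogonal_neg (B : LinearMap.BilinForm 𝕜 V) (W : Submodule 𝕜 V)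
    (hpos : ∀ w ∈ W, w ≠ 0 → 0 < B w w)
    (hneg : ∀ y ∈ LinearMap.BilinForm.orthogonal B W, y ≠ 0 → B y y < 0) :
    (sigPos B.toQuadraticMap : ℤ) - sigNeg B.toQuadraticMap = 2 * finrank 𝕜 W - finrank 𝕜 V ∧
      sigPos B.toQuadraticMap + sigNeg B.toQuadraticMap = finrank 𝕜 V := by
  obtain ⟨h1, h2⟩ := sigPos_sigNeg_of_posDef_of_orthogonal_neg B W hpos hneg
  constructor <;> omega

omit [LinearOrder 𝕜] [IsStrictOrderedRing 𝕜] [FiniteDimensional 𝕜 V] in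
/-- The form of `-B` is `-Q`. [folklore] -/
private theorem toQuadraticMap_neg (B : LinearMap.BilinForm 𝕜 V) :
    (-B).toQuadraticMap = -B.toQuadraticMap := by
  ext x
  rw [QuadraticMap.neg_apply, LinearMap.BilinMap.toQuadraticMap_apply,
    LinearMap.BilinMap.toQuadraticMap_apply, LinearMap.neg_apply, LinearMap.neg_apply]

omit [LinearOrder 𝕜] [IsStrictOrderedRing 𝕜] [FiniteDimensional 𝕜 V] in
/-- `W^⊥` for `-B` is `W^⊥` for `B`. [folklore] -/
private theorem orthogonal_neg (B : LinearMap.BilinForm 𝕜 V) (W : Submodule 𝕜 V) :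
    LinearMap.BilinForm.orthogonal (-B) W = LinearMap.BilinForm.orthogonal B W := by
  ext y
  simp only [LinearMap.BilinForm.mem_orthogonal_iff, LinearMap.neg_apply, neg_eq_zero]

/-- **Mirror statement**: if `B` is negative definite on `W` and positive definite on `W^⊥`, then
`b⁻(Q) = dim W` and `b⁺(Q) = dim V - dim W` (apply the previous theorem to `-B`, `b^±(-Q) = b^∓(Q)`).
[cite: Lang1987LinearAlgebra, Ch. V §8 Thm. 8.2 and Exercise 2] -/
theorem sigNeg_sigPos_of_negDef_of_orthogonal_pos (B : LinearMap.BilinForm 𝕜 V) (W : Submodule 𝕜 V)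
    (hneg : ∀ w ∈ W, w ≠ 0 → B w w < 0)
    (hpos : ∀ y ∈ LinearMap.BilinForm.orthogonal B W, y ≠ 0 → 0 < B y y) :
    sigNeg B.toQuadraticMap = finrank 𝕜 W ∧ sigPos B.toQuadraticMap + finrank 𝕜 W = finrank 𝕜 V := by
  have hpos' : ∀ w ∈ W, w ≠ 0 → 0 < (-B) w w := fun w hw hw0 ↦ by
    rw [LinearMap.neg_apply, LinearMap.neg_apply, neg_pos]
    exact hneg w hw hw0
  have hneg' : ∀ y ∈ LinearMap.BilinForm.orthogonal (-B) W, y ≠ 0 → (-B) y y < 0 := fun y hy hy0 ↦ by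
    rw [LinearMap.neg_apply, LinearMap.neg_apply, neg_neg_iff_pos]
    rw [orthogonal_neg] at hy
    exact hpos y hy hy0
  obtain ⟨h1, h2⟩ := sigPos_sigNeg_of_posDef_of_orthogonal_neg (-B) W hpos' hneg'
  rw [toQuadraticMap_neg] at h1 h2
  have h3 : sigNeg (-B.toQuadraticMap) = sigPos B.toQuadraticMap := by
    change sigPos (- -B.toQuadraticMap) = _
    rw [neg_neg]
  rw [h3] at h2
  exact ⟨h1, h2⟩

/-- **Splitting along an injective linear map**: if `f : U → V` is injective, `B` is positive definite
on the image of `f` and negative definite on its `B`-orthogonal, then `b⁺(Q) = dim U` and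
`b⁻(Q) = dim V - dim U` (the shape used with `U = H^{2,0} × ℝ`, `f (σ, c) = re σ + c κ` in the Hodge
index theorem for surfaces). [cite: Lang1987LinearAlgebra, Ch. V §8 Thm. 8.2 and Exercise 2] -/
theorem sigPos_sigNeg_of_posDef_range {U : Type*} [AddCommGroup U] [Module 𝕜 U]
    (B : LinearMap.BilinForm 𝕜 V) (f : U →ₗ[𝕜] V) (hf : Function.Injective f)
    (hpos : ∀ u : U, u ≠ 0 → 0 < B (f u) (f u))
    (hneg : ∀ y : V, (∀ u : U, B (f u) y = 0) → y ≠ 0 → B y y < 0) :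
    sigPos B.toQuadraticMap = finrank 𝕜 U ∧ sigNeg B.toQuadraticMap + finrank 𝕜 U = finrank 𝕜 V := by
  have hpos' : ∀ w ∈ LinearMap.range f, w ≠ 0 → 0 < B w w := by
    rintro _ ⟨u, rfl⟩ hu
    exact hpos u (fun h ↦ hu (by rw [h, map_zero]))
  have hneg' : ∀ y ∈ LinearMap.BilinForm.orthogonal B (LinearMap.range f), y ≠ 0 → B y y < 0 :=
    fun y hy hy0 ↦ hneg y (fun u ↦ (LinearMap.BilinForm.mem_orthogonal_iff.1 hy) (f u)
      (LinearMap.mem_range_self f u)) hy0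
  obtain ⟨h1, h2⟩ := sigPos_sigNeg_of_posDef_of_orthogonal_neg B (LinearMap.range f) hpos' hneg'
  rw [LinearMap.finrank_range_of_inj hf] at h1 h2
  exact ⟨h1, h2⟩

/-! ### Two complementary definite subspaces (no orthogonality needed) -/

/-- **Sylvester's law from two definite subspaces of complementary dimensions**: if `B` is positive
definite on `W₊`, negative definite on `W₋`, and `dim W₊ + dim W₋ ≥ dim V` (e.g. `V = W₊ ⊕ W₋`), then
`b⁺(Q) = dim W₊` and `b⁻(Q) = dim W₋` — `dim W₊ ≤ b⁺`, `dim W₋ ≤ b⁻`, and a positive definite and a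
non-positive subspace meet trivially (`b⁺ + dim W₋ ≤ dim V`, `b⁻ + dim W₊ ≤ dim V`). No orthogonality of
`W₊` and `W₋` is required (Lang V §8 Exercise 2: the dimensions of `V⁺`, `V⁻` in ANY decomposition
`V = V⁺ ⊕ V⁻ ⊕ V₀` are the indices). [cite: Lang1987LinearAlgebra, Ch. V §8 Thm. 8.2 and Exercise 2] -/
theorem sigPos_sigNeg_of_posDef_of_negDef (B : LinearMap.BilinForm 𝕜 V) (Wp Wn : Submodule 𝕜 V)
    (hpos : ∀ w ∈ Wp, w ≠ 0 → 0 < B w w) (hneg : ∀ w ∈ Wn, w ≠ 0 → B w w < 0)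
    (hdim : finrank 𝕜 V ≤ finrank 𝕜 Wp + finrank 𝕜 Wn) :
    sigPos B.toQuadraticMap = finrank 𝕜 Wp ∧ sigNeg B.toQuadraticMap = finrank 𝕜 Wn ∧
      finrank 𝕜 Wp + finrank 𝕜 Wn = finrank 𝕜 V := by
  set Q := B.toQuadraticMap with hQdef
  have hQ : ∀ x, Q x = B x x := fun x ↦ LinearMap.BilinMap.toQuadraticMap_apply B x
  have hposW : (Q.restrict Wp).PosDef := fun x hx ↦ by
    rw [QuadraticMap.restrict_apply, hQ]
    exact hpos x.1 x.2 (fun h ↦ hx (Subtype.ext h))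
  have hnegW : ((-Q).restrict Wn).PosDef := fun x hx ↦ by
    rw [QuadraticMap.restrict_apply, QuadraticMap.neg_apply, hQ, neg_pos]
    exact hneg x.1 x.2 (fun h ↦ hx (Subtype.ext h))
  have hnonpos : ∀ x ∈ Wn, Q x ≤ 0 := fun x hx ↦ by
    by_cases hx0 : x = 0
    · rw [hx0, hQ, LinearMap.map_zero₂]
    · rw [hQ]; exact (hneg x hx hx0).le
  have hnonneg : ∀ x ∈ Wp, (-Q) x ≤ 0 := fun x hx ↦ by
    rw [QuadraticMap.neg_apply, neg_nonpos, hQ]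
    by_cases hx0 : x = 0
    · rw [hx0, LinearMap.map_zero₂]
    · exact (hpos x hx hx0).le
  have h1 := le_sigPos_of_posDef Q hposW
  have h2 := le_sigNeg_of_negDef Q hnegW
  have h3 := QuadraticForm.sigPos_add_finrank_le_of_nonpos (Q := Q) hnonpos
  have h4 : sigNeg Q + finrank 𝕜 Wp ≤ finrank 𝕜 V :=
    QuadraticForm.sigPos_add_finrank_le_of_nonpos (Q := -Q) hnonneg
  refine ⟨?_, ?_, ?_⟩ <;> omega

/-- The signature from two complementary definite subspaces: `b⁺(Q) - b⁻(Q) = dim W₊ - dim W₋`.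
[cite: Lang1987LinearAlgebra, Ch. V §8 Thm. 8.2 and Exercise 2] -/
theorem signature_eq_of_posDef_of_negDef (B : LinearMap.BilinForm 𝕜 V) (Wp Wn : Submodule 𝕜 V)
    (hpos : ∀ w ∈ Wp, w ≠ 0 → 0 < B w w) (hneg : ∀ w ∈ Wn, w ≠ 0 → B w w < 0)
    (hdim : finrank 𝕜 V ≤ finrank 𝕜 Wp + finrank 𝕜 Wn) :
    (sigPos B.toQuadraticMap : ℤ) - sigNeg B.toQuadraticMap = finrank 𝕜 Wp - finrank 𝕜 Wn := by
  obtain ⟨h1, h2, -⟩ := sigPos_sigNeg_of_posDef_of_negDef B Wp Wn hpos hneg hdim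
  omega

end Literature.LinearAlgebra.QuadraticForm

end
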